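import Literature.Analysis.FluidPDE.FluidComputer.SpecArithmetic
import Literature.Analysis.FluidPDE.FluidComputer.CascadeWitness
import HarnessLib

/-!
# Fluid computer blueprint — pump gadgets and the self-replicating pump cascade (mild twin)

HONEST FRAMING: low prior, high value-of-information experiment on Tao's machine paradigm; NOT a
claim that NS blows up.

This file refines the `CascadeWitness` interface (`CascadeWitness.lean`) one level down, to the
grain at which Tao (2016, §1.3 pp. 10–11; §5–§6 for the averaged equation) describes his machine:
a **pump gadget** per generation `n` — a set of input states with a certified amount `E_n` of
energy at frequencies `|ξ| ≥ λ_n`, a set of output states, a firing time `T_n`, and the single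
fluid-mechanical obligation `fires` (every `H¹⁰_df`-mild Navier–Stokes trajectory entering the input
set and living `T_n` longer passes through the output set) — and a **pump cascade** (`PumpCascade S`, a library of such gadgets) over a spec
sheet `S : CascadeSpecs` (`SpecArithmetic.lean`): one gadget per generation at scale `λ_n = 2ⁿλ₀`,
outputs of generation `n` accepted as inputs of generation `n+1` (the von Neumann self-replication
requirement, which also absorbs leakage / robustness: the next input set must tolerate whatever the
previous output set allows), energy floors `≥ E₀ηⁿ`, firing times `≤ C λ_n^{-α}`, and an ignition
datum in the generation-`0` input set.

Proved here (soft, unconditional):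
* `bernstein_highFreq` — `κ² · ∫_{|ξ|≥κ} |v̂|² ≤ ‖v‖²_{H¹}` (energy `E` at frequencies `≥ κ` forces
  `‖v‖²_{H¹} ≥ κ²E`);
* `PumpCascade.toCascadeWitness` — a pump cascade with `α > 0` (summable times) and `η > 1/4`
  (`E_n λ_n² → ∞`) IS a cascade witness, hence (`CascadeWitness.lean`, Theorems A and B)
* `PumpCascade.lifespan_le` — every mild trajectory from its ignition datum lives at most
  `T_* = ∑ C λ_n^{-α}`, and `PumpCascade.x5a` — X5a (finite-time classical blow-up), conditional on
  the two named standard facts `H10MildTheory`, `MildMaximalGivesBlowup` (all clauses proved in the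
  tree on the summit side).

Relation to the classical twin `Literature/Analysis/FluidPDE/FluidComputerGadget.lean`
(`GadgetSpec`, `GadgetLibrary ν σ`, `GadgetLibrary.no_global_regular_solution`; blueprint seat bp2):
there the realisation hypothesis `step` is quantified over smooth bounded-energy (Clay-class)
solutions and the contradiction is read off a pointwise speed floor, which needs the extra
point-concentration hypothesis F4 (`GadgetLibrary.floor`); here `fires` is quantified over
`H¹⁰_df`-mild solutions, the floor is a THEOREM (`bernstein_highFreq`: spectral energy `E` at
`|ξ| ≥ κ` has `H¹`-size `κ²E`, no codimension condition), and the output is the blow-up object X5a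
itself rather than the non-existence of a global regular solution; the price is the mild solution
theory (`H10MildTheory`, `MildMaximalGivesBlowup`), which the tree has already paid on the summit
side.

Which fields are physically plausible and which are idea-bound is the subject of the blueprint's
`ASSEMBLY.md`; in one line: everything except `PumpGadget.fires` and `PumpCascade.replicate` is
bookkeeping, and those two fields are exactly Tao's open programme (logic gates of ideal fluid,
self-replication, noise tolerance, and — recorded by `CascadeSpecs.viscousNumber` — the requirement
`α ≥ 2`, i.e. `η ≥ 1/2` under the dimensional closure `T_n ∼ λ_n^{-5/2} E_n^{-1/2}`, to outrun
viscosity). Nothing here asserts that a pump cascade exists.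

## References

* T. Tao, *Finite time blowup for an averaged three-dimensional Navier–Stokes equation*, J. Amer.
  Math. Soc. 29 (2016) 601–674, arXiv:1402.0290v3: §1.3 pp. 10–11; §5 Prop. 5.1; §6 Thm. 6.2,
  Props. 6.3–6.5. [Tao2016AveragedNS]
-/

noncomputable section

open MeasureTheory Set Filter Topology
open scoped ENNReal NNReal SchwartzMap

namespace Literature.Analysis.FluidPDE.FluidComputer

open Literature.Analysis.FluidPDE.Tao2016
open Literature.Analysis.FunctionSpaces (eFourierSobolevNorm)

/-! ### Energy at high frequencies and the Bernstein floor -/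

/-- The (Plancherel) energy of `v ∈ L²(ℝ³; ℂ³)` carried by frequencies `|ξ| ≥ κ`:
`∫_{|ξ| ≥ κ} |v̂(ξ)|² dξ`. [folklore] -/
def highFreqEnergy (κ : ℝ) (v : L2C) : ℝ≥0∞ :=
  ∫⁻ ξ in {ξ : EuclideanSpace ℝ (Fin 3) | κ ≤ ‖ξ‖}, ‖fourierFn v ξ‖ₑ ^ 2

/-- `‖v‖²_{H¹} = ∫ (1+|ξ|²) |v̂(ξ)|² dξ` (the square of the square root). [folklore] -/
theorem eFourierSobolevNorm_one_sq (v : L2C) :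
    eFourierSobolevNorm 1 v ^ 2 =
      ∫⁻ ξ, ENNReal.ofReal (1 + ‖ξ‖ ^ 2) * ‖fourierFn v ξ‖ₑ ^ 2 := by
  unfold eFourierSobolevNorm fourierFn
  rw [← ENNReal.rpow_natCast, ← ENNReal.rpow_mul]
  norm_num

/-- **Bernstein floor**: energy `E` at frequencies `|ξ| ≥ κ ≥ 0` forces `‖v‖²_{H¹} ≥ κ² E`, i.e.
`κ² · ∫_{|ξ|≥κ} |v̂|² ≤ ∫ (1+|ξ|²)|v̂|²`. [folklore] -/
theorem bernstein_highFreq {κ : ℝ} (hκ : 0 ≤ κ) (v : L2C) :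
    ENNReal.ofReal (κ ^ 2) * highFreqEnergy κ v ≤ eFourierSobolevNorm 1 v ^ 2 := by
  rw [eFourierSobolevNorm_one_sq, highFreqEnergy, ← lintegral_const_mul' _ _ ENNReal.ofReal_ne_top]
  have hS : MeasurableSet {ξ : EuclideanSpace ℝ (Fin 3) | κ ≤ ‖ξ‖} :=
    measurableSet_le measurable_const measurable_norm
  calc ∫⁻ ξ in {ξ : EuclideanSpace ℝ (Fin 3) | κ ≤ ‖ξ‖}, ENNReal.ofReal (κ ^ 2) * ‖fourierFn v ξ‖ₑ ^ 2
      ≤ ∫⁻ ξ in {ξ : EuclideanSpace ℝ (Fin 3) | κ ≤ ‖ξ‖},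
          ENNReal.ofReal (1 + ‖ξ‖ ^ 2) * ‖fourierFn v ξ‖ₑ ^ 2 := by
        refine setLIntegral_mono' hS fun ξ hξ => mul_le_mul' (ENNReal.ofReal_le_ofReal ?_) le_rfl
        have : κ ^ 2 ≤ ‖ξ‖ ^ 2 := pow_le_pow_left₀ hκ hξ 2
        linarith
    _ ≤ ∫⁻ ξ, ENNReal.ofReal (1 + ‖ξ‖ ^ 2) * ‖fourierFn v ξ‖ₑ ^ 2 := setLIntegral_le_lintegral _ _

/-! ### Pump gadgets -/

/-- **A pump gadget** at frequency scale `κ` for the TRUE Navier–Stokes equations (`ν = 1`, Tao's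
`H¹⁰_df`-mild formulation of the Euler form): the unit of Tao's machine (2016, §1.3) at one
generation.

* `In` — the input configurations (an `L²`-set of states: "a machine at scale `κ`, loaded");
* `Ein`, `in_floor` — every input state carries energy `≥ Ein` at frequencies `|ξ| ≥ κ`;
* `Out` — the output configurations ("the rescaled copy, loaded, plus tolerated debris");
* `T ≥ 0` — the time-to-fire allowance;
* `fires` — REALISATION (idea-bound; all the fluid mechanics): every `H¹⁰_df`-mild Navier–Stokes
  trajectory, from ANY `H¹⁰_df` datum, that is in `In` at a time `t ≥ 0` and lives past `t + T`
  passes through `Out` at some time in `[t, t + T]`. Stating it for all data and all entry times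
  makes the gadget context-free (autonomous), as a reusable component must be.

Efficiency and leakage are not fields of a single gadget: they are the cascade-level requirements
that the NEXT gadget's input set accept this gadget's output set (`PumpCascade.replicate`) while
still certifying the next energy floor (`PumpCascade.energy`). [cite: Tao2016AveragedNS, §1.3 pp. 10–11] -/
structure PumpGadget where
  /-- frequency scale -/
  κ : ℝ
  κ_nonneg : 0 ≤ κ
  /-- input configurations -/
  In : Set L2C
  /-- output configurations -/
  Out : Set L2C
  /-- certified input energy at frequencies `≥ κ` -/
  Ein : ℝ
  in_floor : ∀ v ∈ In, ENNReal.ofReal Ein ≤ highFreqEnergy κ v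
  /-- time-to-fire allowance -/
  T : ℝ
  T_nonneg : 0 ≤ T
  /-- REALISATION (idea-bound): the Navier–Stokes flow carries `In` through `Out` within time `T` -/
  fires : ∀ (a : L2C) (S : ℝ) (u : ℝ → L2C), IsMildSolutionFor eulerForm a (Ico 0 S) u →
    ∀ t : ℝ, 0 ≤ t → u t ∈ In → t + T < S → ∃ s : ℝ, t ≤ s ∧ s ≤ t + T ∧ u s ∈ Out

/-- The `H¹` floor of a gadget's input set: `‖v‖²_{H¹} ≥ κ² Ein` on `In` (Bernstein). [folklore] -/
theorem PumpGadget.sq_mul_Ein_le (G : PumpGadget) {v : L2C} (hv : v ∈ G.In) :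
    ENNReal.ofReal (G.κ ^ 2 * G.Ein) ≤ eFourierSobolevNorm 1 v ^ 2 := by
  by_cases hE : 0 ≤ G.Ein
  · rw [ENNReal.ofReal_mul (sq_nonneg _)]
    exact (mul_le_mul' le_rfl (G.in_floor v hv)).trans (bernstein_highFreq G.κ_nonneg v)
  · rw [ENNReal.ofReal_of_nonpos (mul_nonpos_of_nonneg_of_nonpos (sq_nonneg _) (not_le.1 hE).le)]
    exact bot_le

/-! ### The self-replicating pump cascade over a spec sheet -/

/-- **A pump cascade** (a self-replicating library of pump gadgets) realising the spec sheet `S` (`CascadeSpecs`: `λ_n = 2ⁿλ₀`,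
`T_n ≤ C λ_n^{-α}`, `E_n ≥ E₀ ηⁿ`) in the TRUE Navier–Stokes equations: Tao's machine programme
(2016, §1.3) as a list of typed obligations.

* `G n` — the generation-`n` pump gadget, at scale `scale : (G n).κ = λ_n`;
* `replicate` — VON NEUMANN SELF-REPLICATION WITH TOLERANCE (idea-bound): every output state of
  generation `n` is an input state of generation `n+1` (the output IS a loaded machine at the next
  scale, and the next machine tolerates the debris / leakage the previous one leaves);
* `energy` — the input floors dominate the spec's `E_n = E₀ηⁿ` (efficiency `≥ η` per generation);
* `time` — the firing allowances are within the spec's `T_n = Cλ_n^{-α}` (abruptness);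
* `u₀`, `divFree`, `memH10df`, `ignite` — IGNITION: a divergence-free Schwartz datum that is a
  generation-`0` input state.

Nothing asserts such a cascade exists; `toCascadeWitness` says what it would buy. [cite: Tao2016AveragedNS, §1.3 pp. 10–11] -/
structure PumpCascade (S : CascadeSpecs) where
  /-- one pump gadget per generation -/
  G : ℕ → PumpGadget
  /-- at the spec's frequency scales -/
  scale : ∀ n, (G n).κ = S.lam n
  /-- self-replication with tolerance (idea-bound) -/
  replicate : ∀ n, (G n).Out ⊆ (G (n + 1)).In
  /-- efficiency: floors at least `E₀ ηⁿ` -/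
  energy : ∀ n, S.Emin n ≤ (G n).Ein
  /-- abruptness: firing within `C λ_n^{-α}` -/
  time : ∀ n, (G n).T ≤ S.Tmax n
  /-- the ignition datum -/
  u₀ : 𝓢(EuclideanSpace ℝ (Fin 3), EuclideanSpace ℝ (Fin 3))
  divFree : VectorCalculus.IsDivFree ⇑u₀
  /-- its `L²` class lies in `H¹⁰_df` (a theorem of the tree for every such `u₀`) -/
  memH10df : MemH10df (schwartzL2 u₀)
  /-- ignition: the datum is a generation-`0` input state -/
  ignite : schwartzL2 u₀ ∈ (G 0).In

namespace PumpCascade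

variable {S : CascadeSpecs} (L : PumpCascade S)

/-- The firing allowances of a pump cascade are summable as soon as `α > 0`. [folklore] -/
theorem summable_T (hα : 0 < S.alpha) : Summable fun n => (L.G n).T :=
  (S.summable_Tmax hα).of_nonneg_of_le (fun n => (L.G n).T_nonneg) L.time

/-- On the generation-`n` input set, `‖v‖²_{H¹} ≥ E_n λ_n²` (Bernstein at scale `λ_n` and the
efficiency requirement). [folklore] -/
theorem concentration_le_of_mem (n : ℕ) {v : L2C} (hv : v ∈ (L.G n).In) :
    ENNReal.ofReal (S.concentration n) ≤ eFourierSobolevNorm 1 v ^ 2 := by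
  refine le_trans (ENNReal.ofReal_le_ofReal ?_) ((L.G n).sq_mul_Ein_le hv)
  rw [CascadeSpecs.concentration, L.scale n, mul_comm]
  exact mul_le_mul_of_nonneg_left (L.energy n) (sq_nonneg _)

/-- **A pump cascade is a cascade witness** (`α > 0`: summable firing times; `η > 1/4`: the `H¹`
floors `E_n λ_n² = E₀λ₀²(4η)ⁿ` diverge): stages = input sets, allowances = firing times, floors =
`E_n λ_n²`, and the cascade's `fires` = the gadgets' `fires` chained through `replicate`. [cite: Tao2016AveragedNS, §1.3 pp. 10–11] -/
def toCascadeWitness (hα : 0 < S.alpha) (hη : 1 / 4 < S.eta) : CascadeWitness where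
  u₀ := L.u₀
  divFree := L.divFree
  memH10df := L.memH10df
  stage n := (L.G n).In
  T n := (L.G n).T
  T_nonneg n := (L.G n).T_nonneg
  summable_T := L.summable_T hα
  floor := S.concentration
  tendsto_floor := S.tendsto_concentration_atTop hη
  floor_le n v hv := L.concentration_le_of_mem n hv
  ignition := L.ignite
  fires S' u hu n t ht hmem hS' := by
    obtain ⟨s, hts, hst, hs⟩ := (L.G n).fires _ S' u hu t ht hmem hS'
    exact ⟨s, hts, hst, L.replicate n hs⟩

/-- **Lifespan bound for a pump cascade** (unconditional given the cascade): every
`H¹⁰_df`-mild Navier–Stokes trajectory from the ignition datum lives at most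
`T_* = ∑ₙ (G n).T ≤ C λ₀^{-α}/(1 - 2^{-α})`. [cite: Tao2016AveragedNS, §1.3 pp. 10–11] -/
theorem lifespan_le (hα : 0 < S.alpha) (hη : 1 / 4 < S.eta) {S' : ℝ} {u : ℝ → L2C}
    (hu : IsMildSolutionFor eulerForm (schwartzL2 L.u₀) (Ico 0 S') u) : S' ≤ S.Tstar :=
  ((L.toCascadeWitness hα hη).lifespan_le hu).trans
    ((L.summable_T hα).tsum_le_tsum L.time (S.summable_Tmax hα))

/-- **X5a from a pump cascade**, conditional on the two named standard facts of
`CascadeWitness.lean` (all clauses proved in the tree on the summit side): a pump cascade with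
`α > 0`, `η > 1/4` in the true Navier–Stokes equations gives a finite-energy classical solution from
a rapidly decaying datum with finite maximal time of smooth existence. On the summit side this is
`¬ NavierStokesRegularity` (landed `blowup_assembly` + `blowup_clay_uniqueness`). HONEST FRAMING: an
implication from an uninhabited-as-far-as-anyone-knows structure. [cite: Tao2016AveragedNS, §1.3 pp. 10–11] -/
theorem x5a (Lib : PumpCascade S) (hth : H10MildTheory) (hblow : MildMaximalGivesBlowup)
    (hα : 0 < S.alpha) (hη : 1 / 4 < S.eta) :
    ∃ ν : ℝ, 0 < ν ∧ ∃ T : ℝ, 0 < T ∧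
      ∃ (u : ℝ → EuclideanSpace ℝ (Fin 3) → EuclideanSpace ℝ (Fin 3))
        (p : ℝ → EuclideanSpace ℝ (Fin 3) → ℝ),
        IsMaximalSmoothSolution ν 0 u p T ∧ IsLerayHopfOn T ν 0 (u 0) u ∧ HasRapidSpatialDecay (u 0) :=
  x5a_of_cascadeWitness hth hblow (Lib.toCascadeWitness hα hη)

/-- **Norm blow-up from a pump cascade**: with `H10MildTheory`, the ignition datum has a maximal
mild Navier–Stokes solution on some `[0,S_m)`, `S_m ≤ T_*`, with unbounded `H¹⁰` norm — energy has
reached arbitrarily fine scales in finite time. [cite: Tao2016AveragedNS, §1.3 pp. 10–11] -/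
theorem normBlowup (hth : H10MildTheory) (hα : 0 < S.alpha) (hη : 1 / 4 < S.eta) :
    ∃ Sm : ℝ, 0 < Sm ∧ Sm ≤ S.Tstar ∧ ∃ U : ℝ → L2C,
      IsMildSolutionFor eulerForm (schwartzL2 L.u₀) (Ico 0 Sm) U ∧
      ∀ C : ℝ, ∃ t ∈ Ico 0 Sm, ENNReal.ofReal C < eFourierSobolevNorm 10 (U t) := by
  obtain ⟨Sm, hSm, hle, U, hU, hunb⟩ := normBlowup_of_cascadeWitness hth (L.toCascadeWitness hα hη)
  exact ⟨Sm, hSm, hle.trans ((L.summable_T hα).tsum_le_tsum L.time (S.summable_Tmax hα)), U, hU, hunb⟩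

/-- **The viscosity ledger of a pump cascade** (bookkeeping, not used by the soft assembly): if the
spec has `α ≥ 2` the viscous damping exponent `ν λ_n² T_n` available to destroy generation `n`
during its own firing window is bounded uniformly in `n` (by `ν C λ₀^{2-α}`); for `α < 2` it
diverges (`CascadeSpecs.tendsto_viscousNumber_atTop`) and no uniform-efficiency cascade is
plausible. Under the dimensional closure `α = α_eff(η)`, `α ≥ 2 ⟺ η ≥ 1/2`
(`CascadeSpecs.two_le_alphaEff_iff`). [cite: Tao2016AveragedNS, §1.3 pp. 10–11] -/
theorem viscous_exponent_bounded (hα : 2 ≤ S.alpha) (n : ℕ) :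
    (L.G n).κ ^ 2 * (L.G n).T ≤ S.C * S.lam0 ^ (2 - S.alpha) := by
  have h := S.viscousNumber_le hα zero_le_one n
  simp only [CascadeSpecs.viscousNumber, one_mul] at h
  rw [L.scale n]
  exact le_trans (mul_le_mul_of_nonneg_left (L.time n) (sq_nonneg _)) h

end PumpCascade

end Literature.Analysis.FluidPDE.FluidComputer

end
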